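import Summits.Ventures.CertifiedArithmetic.LowPrec.SRRecursionAbsorb
import Summits.Ventures.CertifiedArithmetic.LowPrec.SRRecursionFormats
import HarnessLib

/-!
# SR recursions, V — expected ENTRY TIME of the SR moving average: stochastic rounding never
# stagnates, and lingers exactly `spacing / drift` steps where round-to-nearest is stuck (file LVI)

HONEST FRAMING: certified error envelopes and provably optimal rounding/accumulation schemes for
low-precision formats under stated cost models; every table by two implementations; no hardware or
vendor claims.

The recursion `xₖ₊₁ = SR_F(β xₖ + (1 − β) μ)` (`0 ≤ β < 1`) is the EMA / momentum buffer of a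
constant signal `μ`, equivalently fixed-step gradient descent on a one-dimensional quadratic with
minimiser `μ` carried in the low-precision format `F` (`β = 1 − ηλ`).  Files III/IV settled the
mean (`μ + βⁿ(x₀ − μ)`, no saturation), the in-cell law, and — for a REPRESENTABLE `μ` — geometric
absorption by a Markov bound.  For a target strictly between two grid points Markov's inequality
certifies nothing (the chain keeps fluctuating in the cell `[⌊μ⌋, ⌈μ⌉]` with mean `μ`).  This file
quantifies the ENTRY TIME `T` = first `k` with `xₖ ≤ ⌈μ⌉` from any grid start above the target,
for an arbitrary finite `F` over a linear ordered field and any `μ` in the hull: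

* `hitExp F β μ n x = E_x[min(T, n)]` (backward recursion through the one-step operator `step`),
  `descProb F β μ y` = probability of STRICT DESCENT out of the grid state `y` in one step
  (`1` if even the upper SR candidate lies below `y`, else the round-down probability), and the
  ESCAPE BUDGET `escBudget F β μ x = Σ_{y ∈ F, ⌈μ⌉ < y ≤ x} 1/descProb(y)`.
* `hitExp_le_escBudget` — **for every horizon `n` and every grid start `x`:
  `E_x[min(T, n)] ≤ Σ_{⌈μ⌉ < y ≤ x} 1/descProb(y)`.**  The bound is uniform in `n`, so `T` is
  almost surely finite with `E T ≤ escBudget` (monotone convergence, outside the formal text): the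
  stochastically rounded recursion NEVER stagnates, whatever the spacing.  When the drift
  `δ(y) = (1 − β)(y − μ)` is below the grid spacing `q(y)` under `y` the term is exactly
  `q(y)/δ(y)`; otherwise it is `1`.
* `hitExp_linger_ge` — in the LINGERING regime at `x` (upper candidate `= x`, i.e. `δ(x) < q(x)`):
  `E_x[min(T, n + m)] ≥ (1 − (1 − r)^m)·(1/r + E_{x⁻}[min(T, n)])`, `r = descProb(x)`, `x⁻` the
  lower candidate — so along a fully lingering staircase the budget is ATTAINED in the limit:
  `E T = Σ q(y)/δ(y)` exactly (a pure-death chain with independent geometric sojourns).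
* `linger_of_rn_sep` — wherever round-to-nearest is STUCK (the separation criterion of file III,
  any tie rule: every RN trajectory through `x` is constant for ever), SR lingers with
  `0 < descProb(x) < 1/2`: expected sojourn `q/δ ∈ (2, ∞)` steps, then it leaves.
* FP4 kernel witnesses (`FP4.e2m1_escape_*`): E2M1, `β = 3/4`, `μ = 5/4` (NOT representable; cell
  `[1, 3/2]`): from `x₀ = 3` round-to-nearest is stuck at `3` for ever (relative error `7/5`), SR
  enters the cell with `E[min(T,6)] = 2240901/524288 ≈ 4.27` and `E T = 16/7 + 8/3 = 104/21
  ≈ 4.95` exactly (lingering at `3` and at `2`); from the top of the format `x₀ = 6`,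
  `E T = 32/19 + 16/11 + 16/7 + 8/3 = 35512/4389 ≈ 8.09`.

Nearest prior art (searched; see the unit's FRESHNESS file): Xia, Massei, Hochstenbach & Koren
(arXiv:2202.12276, §4: SR prevents stagnation of low-precision GD, expected one-step progress) and
its fixed-point successor (arXiv:2301.09511); Croci & Giles 2022 (RtN stagnation of parabolic
solvers vs SR).  No entry-time law of this form was found; the statements here are exact and
kernel-checked.
-/

namespace Summit.Ventures.CertifiedArithmetic.LowPrec.SR

open Literature.ComputerArithmetic.ConnollyHighamMary2021
open Finset

section Generic

variable {K : Type*} [Field K] [LinearOrder K] [IsStrictOrderedRing K]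

/-! ### The objects -/

/-- The exact (pre-rounding) EMA / 1-D gradient update `β x + (1 − β) μ`. -/
def emaMap (β μ x : K) : K := β * x + (1 - β) * μ

/-- Probability of STRICT DESCENT out of the grid state `x` in one SR-EMA step: `1` if even the
upper SR candidate of the update lies below `x`, otherwise the round-down probability. -/
def descProb (F : Finset K) (β μ x : K) : K :=
  if up F (emaMap β μ x) < x then 1 else 1 - pUp F (emaMap β μ x)

/-- `E_x[min(T, n)]` for the entry time `T = min {k : xₖ ≤ ⌈μ⌉}` of the SR-EMA, by backward
recursion through the one-step operator. -/
def hitExp (F : Finset K) (β μ : K) : ℕ → K → K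
  | 0, _ => 0
  | n + 1, x => if x ≤ up F μ then 0 else 1 + step F (emaMap β μ x) (hitExp F β μ n)

/-- The ESCAPE BUDGET `Σ_{y ∈ F, ⌈μ⌉ < y ≤ x} 1 / descProb(y)`. -/
def escBudget (F : Finset K) (β μ x : K) : K :=
  ∑ y ∈ F.filter (fun y => up F μ < y ∧ y ≤ x), (descProb F β μ y)⁻¹

omit [LinearOrder K] [IsStrictOrderedRing K] in
/-- Unfolding of the recursion. -/
theorem hitExp_succ (F : Finset K) [LinearOrder K] (β μ : K) (n : ℕ) (x : K) :
    hitExp F β μ (n + 1) x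
      = if x ≤ up F μ then 0 else 1 + step F (emaMap β μ x) (hitExp F β μ n) := rfl

/-! ### One-step geometry above the target -/

omit [LinearOrder K] [IsStrictOrderedRing K] in
/-- The update is the file-I affine map `affMap β ((1 − β)μ)`. -/
theorem emaMap_eq_affMap (β μ : K) (k : ℕ) (x : K) :
    emaMap β μ x = affMap (fun _ => β) (fun _ => (1 - β) * μ) k x := rfl

/-- Strictly above the target the update moves strictly down … -/
theorem emaMap_lt {β μ x : K} (hβ1 : β < 1) (hμx : μ < x) : emaMap β μ x < x := by
  unfold emaMap; nlinarith

/-- … and stays on the target's side. -/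
theorem le_emaMap {β μ x : K} (hβ0 : 0 ≤ β) (hμx : μ ≤ x) : μ ≤ emaMap β μ x := by
  unfold emaMap; nlinarith [mul_nonneg hβ0 (sub_nonneg.2 hμx)]

/-- The update of a hull point towards a hull point is in the hull (no saturation, file IV). -/
theorem emaMap_inHull {F : Finset K} {β μ x : K} (hμ : InHull F μ) (hx : InHull F x)
    (hβ0 : 0 ≤ β) (hβ1 : β ≤ 1) : InHull F (emaMap β μ x) :=
  inHull_conv hx hμ hβ0 hβ1

omit [Field K] [IsStrictOrderedRing K] in
/-- A hull point lies below its upper candidate. -/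
theorem le_up_of_inHull {F : Finset K} {c : K} (hc : InHull F c) : c ≤ up F c := by
  simpa [clamp_eq_self hc] using clamp_le_up F c

omit [Field K] [IsStrictOrderedRing K] in
/-- A hull point lies above its lower candidate. -/
theorem dn_le_of_inHull {F : Finset K} {c : K} (hc : InHull F c) : dn F c ≤ c := by
  simpa [clamp_eq_self hc] using dn_le_clamp F c

/-- **The descent probability is positive** at every grid state strictly above `μ` (`0 ≤ β < 1`,
`μ` in the hull): SR always has a chance to leave. -/
theorem descProb_pos {F : Finset K} {β μ x : K} (hμ : InHull F μ) (hβ0 : 0 ≤ β) (hβ1 : β < 1)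
    (hx : x ∈ F) (hμx : μ < x) : 0 < descProb F β μ x := by
  unfold descProb
  split_ifs with h
  · exact one_pos
  · have hxh : InHull F x := ⟨⟨x, hx, le_rfl⟩, ⟨x, hx, le_rfl⟩⟩
    have hc : InHull F (emaMap β μ x) := emaMap_inHull hμ hxh hβ0 hβ1.le
    have hcx : emaMap β μ x < x := emaMap_lt hβ1 hμx
    have hux : up F (emaMap β μ x) = x :=
      le_antisymm (up_le_of_mem hx hcx.le) (not_lt.mp h)
    have hdc : dn F (emaMap β μ x) ≤ emaMap β μ x := dn_le_of_inHull hc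
    have hp : pUp F (emaMap β μ x) = (emaMap β μ x - dn F (emaMap β μ x))
        / (up F (emaMap β μ x) - dn F (emaMap β μ x)) := by
      unfold pUp probUp dn up; rw [clamp_eq_self hc]
    have hpos : 0 < x - dn F (emaMap β μ x) := by linarith
    rw [hp, hux, sub_pos, div_lt_one hpos]
    linarith

/-- In the lingering case (update rounds up back to `x`) the descent probability is the round-down
probability `(x − c)/(x − ⌊c⌋)` of the update `c`. -/
theorem descProb_of_up_eq {F : Finset K} {β μ x : K} (hμ : InHull F μ) (hβ0 : 0 ≤ β)
    (hβ1 : β < 1) (hx : x ∈ F) (hμx : μ < x) (hux : up F (emaMap β μ x) = x) :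
    descProb F β μ x = (x - emaMap β μ x) / (x - dn F (emaMap β μ x)) := by
  have hxh : InHull F x := ⟨⟨x, hx, le_rfl⟩, ⟨x, hx, le_rfl⟩⟩
  have hc : InHull F (emaMap β μ x) := emaMap_inHull hμ hxh hβ0 hβ1.le
  have hdc : dn F (emaMap β μ x) ≤ emaMap β μ x := dn_le_of_inHull hc
  have hcx : emaMap β μ x < x := emaMap_lt hβ1 hμx
  have hne : x - dn F (emaMap β μ x) ≠ 0 := by linarith
  have hp : pUp F (emaMap β μ x) = (emaMap β μ x - dn F (emaMap β μ x))
      / (up F (emaMap β μ x) - dn F (emaMap β μ x)) := by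
    unfold pUp probUp dn up; rw [clamp_eq_self hc]
  unfold descProb
  rw [if_neg (by rw [hux]; exact lt_irrefl x), hp, hux, eq_div_iff hne, sub_mul,
    div_mul_cancel₀ _ hne]
  ring

/-! ### The escape budget -/

/-- Every term of the budget is non-negative. -/
theorem escBudget_term_nonneg {F : Finset K} {β μ : K} (hμ : InHull F μ) (hβ0 : 0 ≤ β)
    (hβ1 : β < 1) {x y : K} (hy : y ∈ F.filter (fun y => up F μ < y ∧ y ≤ x)) :
    0 ≤ (descProb F β μ y)⁻¹ := by
  obtain ⟨hyF, hy1, -⟩ := Finset.mem_filter.mp hy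
  exact inv_nonneg.mpr (descProb_pos hμ hβ0 hβ1 hyF ((le_up_of_inHull hμ).trans_lt hy1)).le

/-- The budget is non-negative … -/
theorem escBudget_nonneg {F : Finset K} {β μ : K} (hμ : InHull F μ) (hβ0 : 0 ≤ β) (hβ1 : β < 1)
    (x : K) : 0 ≤ escBudget F β μ x :=
  Finset.sum_nonneg fun _ hy => escBudget_term_nonneg hμ hβ0 hβ1 hy

/-- … non-decreasing in the start … -/
theorem escBudget_mono {F : Finset K} {β μ : K} (hμ : InHull F μ) (hβ0 : 0 ≤ β) (hβ1 : β < 1)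
    {z x : K} (hzx : z ≤ x) : escBudget F β μ z ≤ escBudget F β μ x := by
  refine Finset.sum_le_sum_of_subset_of_nonneg (fun y hy => ?_)
    (fun y hy _ => escBudget_term_nonneg hμ hβ0 hβ1 hy)
  obtain ⟨hyF, hy1, hy2⟩ := Finset.mem_filter.mp hy
  exact Finset.mem_filter.mpr ⟨hyF, hy1, hy2.trans hzx⟩

/-- … and drops by the full term `1/descProb(x)` strictly below a grid state `x` above the cell. -/
theorem escBudget_le_sub {F : Finset K} {β μ : K} (hμ : InHull F μ) (hβ0 : 0 ≤ β) (hβ1 : β < 1)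
    {z x : K} (hx : x ∈ F) (hux : up F μ < x) (hzx : z < x) :
    escBudget F β μ z ≤ escBudget F β μ x - (descProb F β μ x)⁻¹ := by
  have hxm : x ∈ F.filter (fun y => up F μ < y ∧ y ≤ x) :=
    Finset.mem_filter.mpr ⟨hx, hux, le_rfl⟩
  unfold escBudget
  rw [← Finset.sum_erase_eq_sub hxm]
  refine Finset.sum_le_sum_of_subset_of_nonneg (fun y hy => ?_)
    (fun y hy _ => escBudget_term_nonneg hμ hβ0 hβ1 (Finset.mem_of_mem_erase hy))
  obtain ⟨hyF, hy1, hy2⟩ := Finset.mem_filter.mp hy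
  exact Finset.mem_erase.mpr ⟨(hy2.trans_lt hzx).ne, Finset.mem_filter.mpr ⟨hyF, hy1, hy2.trans hzx.le⟩⟩

/-! ### The truncated expected entry time -/

/-- `E[min(T, n)] ≥ 0`. -/
theorem hitExp_nonneg (F : Finset K) (β μ : K) : ∀ (n : ℕ) (x : K), 0 ≤ hitExp F β μ n x
  | 0, _ => le_rfl
  | n + 1, x => by
      rw [hitExp_succ]
      split_ifs
      · exact le_rfl
      · unfold step
        have hp := pUp_nonneg F (emaMap β μ x)
        have hq : 0 ≤ 1 - pUp F (emaMap β μ x) := sub_nonneg.mpr (pUp_le_one F _)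
        have h1 := hitExp_nonneg F β μ n (up F (emaMap β μ x))
        have h2 := hitExp_nonneg F β μ n (dn F (emaMap β μ x))
        positivity

/-- `E[min(T, n)]` is non-decreasing in the horizon. -/
theorem hitExp_le_succ (F : Finset K) (β μ : K) :
    ∀ (n : ℕ) (x : K), hitExp F β μ n x ≤ hitExp F β μ (n + 1) x
  | 0, x => hitExp_nonneg F β μ 1 x
  | n + 1, x => by
      rw [hitExp_succ F β μ n, hitExp_succ F β μ (n + 1)]
      split_ifs
      · exact le_rfl
      · have h := step_mono_on F (emaMap β μ x) (f := hitExp F β μ n) (g := hitExp F β μ (n + 1))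
          (hitExp_le_succ F β μ n _) (hitExp_le_succ F β μ n _)
        linarith

/-- Monotonicity in the horizon, general form. -/
theorem hitExp_mono {F : Finset K} {β μ : K} {n m : ℕ} (h : n ≤ m) (x : K) :
    hitExp F β μ n x ≤ hitExp F β μ m x := by
  induction h with
  | refl => exact le_rfl
  | step _ ih => exact ih.trans (hitExp_le_succ F β μ _ x)

/-- **SR NEVER STAGNATES: the expected entry time is bounded by the escape budget.**  For `μ` in
the hull, `0 ≤ β < 1`, every horizon `n` and every grid start `x ∈ F`:
`E_x[min(T, n)] ≤ Σ_{y ∈ F, ⌈μ⌉ < y ≤ x} 1/descProb(y)`.  (Below or inside the cell both sides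
are `0`/non-negative.)  The proof is the pure-death-chain induction: from `x` the chain moves to a
grid point `≤ x`; a sure descent costs the term `1 ≤ 1/descProb(x)`, a lingering step costs `1`
against the expected drop `descProb(x)·(1/descProb(x)) = 1` of the budget. [new] -/
theorem hitExp_le_escBudget {F : Finset K} {β μ : K} (hμ : InHull F μ) (hβ0 : 0 ≤ β)
    (hβ1 : β < 1) : ∀ (n : ℕ) {x : K}, x ∈ F → hitExp F β μ n x ≤ escBudget F β μ x := by
  intro n
  induction n with
  | zero => intro x _; exact escBudget_nonneg hμ hβ0 hβ1 x
  | succ n ih =>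
      intro x hx
      rw [hitExp_succ]
      split_ifs with hxu
      · exact escBudget_nonneg hμ hβ0 hβ1 x
      · have hux : up F μ < x := not_le.mp hxu
        have hF : F.Nonempty := ⟨x, hx⟩
        have hμx : μ < x := (le_up_of_inHull hμ).trans_lt hux
        have hxh : InHull F x := ⟨⟨x, hx, le_rfl⟩, ⟨x, hx, le_rfl⟩⟩
        have hc : InHull F (emaMap β μ x) := emaMap_inHull hμ hxh hβ0 hβ1.le
        have hcx : emaMap β μ x < x := emaMap_lt hβ1 hμx
        have huc : up F (emaMap β μ x) ≤ x := up_le_of_mem hx hcx.le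
        have hdc : dn F (emaMap β μ x) < x := (dn_le_of_inHull hc).trans_lt hcx
        have h1 : step F (emaMap β μ x) (hitExp F β μ n) ≤ step F (emaMap β μ x) (escBudget F β μ) :=
          step_mono_on F _ (ih (up_mem hF _)) (ih (dn_mem hF _))
        have hp := pUp_nonneg F (emaMap β μ x)
        have hq : 0 ≤ 1 - pUp F (emaMap β μ x) := sub_nonneg.mpr (pUp_le_one F _)
        have hEd := escBudget_le_sub hμ hβ0 hβ1 hx hux hdc
        rcases lt_or_eq_of_le huc with hlt | heq
        · -- sure descent: both candidates are strictly below `x`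
          have hr : descProb F β μ x = 1 := by unfold descProb; rw [if_pos hlt]
          have hEu := escBudget_le_sub hμ hβ0 hβ1 hx hux hlt
          rw [hr, inv_one] at hEu hEd
          have h2 : step F (emaMap β μ x) (escBudget F β μ) ≤ escBudget F β μ x - 1 := by
            unfold step
            nlinarith [mul_le_mul_of_nonneg_left hEu hp, mul_le_mul_of_nonneg_left hEd hq]
          linarith
        · -- lingering step: upper candidate `= x`, lower candidate `< x`
          have hr : descProb F β μ x = 1 - pUp F (emaMap β μ x) := by
            unfold descProb; rw [if_neg (by rw [heq]; exact lt_irrefl x)]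
          have hrpos : 0 < descProb F β μ x := descProb_pos hμ hβ0 hβ1 hx hμx
          have hone : (1 - pUp F (emaMap β μ x)) * (descProb F β μ x)⁻¹ = 1 := by
            rw [← hr]; exact mul_inv_cancel₀ hrpos.ne'
          have h2 : step F (emaMap β μ x) (escBudget F β μ) ≤ escBudget F β μ x - 1 := by
            unfold step
            rw [heq]
            nlinarith [mul_le_mul_of_nonneg_left hEd hq]
          linarith

/-- **THE LINGERING LOWER BOUND.**  At a grid state `x` above the cell whose update rounds UP back
to `x` itself (drift below the spacing), with `r = descProb(x)` and `x⁻ = ⌊update⌋` the lower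
candidate: for all horizons `m, n`,
`(1 − (1 − r)^m)·(1/r + E_{x⁻}[min(T, n)]) ≤ E_x[min(T, n + m)]`.
Letting `m, n → ∞` along a staircase of lingering states the escape budget is attained:
`E T = Σ q(y)/δ(y)` exactly. [new] -/
theorem hitExp_linger_ge {F : Finset K} {β μ x : K} (hμ : InHull F μ) (hβ0 : 0 ≤ β) (hβ1 : β < 1)
    (hx : x ∈ F) (hux : up F μ < x) (hlin : up F (emaMap β μ x) = x) (m n : ℕ) :
    (1 - (1 - descProb F β μ x) ^ m)
        * ((descProb F β μ x)⁻¹ + hitExp F β μ n (dn F (emaMap β μ x)))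
      ≤ hitExp F β μ (n + m) x := by
  have hμx : μ < x := (le_up_of_inHull hμ).trans_lt hux
  have hr : descProb F β μ x = 1 - pUp F (emaMap β μ x) := by
    unfold descProb; rw [if_neg (by rw [hlin]; exact lt_irrefl x)]
  have hrpos : 0 < descProb F β μ x := descProb_pos hμ hβ0 hβ1 hx hμx
  have hinv : descProb F β μ x * (descProb F β μ x)⁻¹ = 1 := mul_inv_cancel₀ hrpos.ne'
  induction m with
  | zero => simpa using hitExp_nonneg F β μ n x
  | succ m ih =>
      rw [← Nat.add_assoc, hitExp_succ, if_neg (not_le.mpr hux)]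
      unfold step
      rw [hlin]
      have hb : hitExp F β μ n (dn F (emaMap β μ x)) ≤ hitExp F β μ (n + m) (dn F (emaMap β μ x)) :=
        hitExp_mono (Nat.le_add_right n m) _
      have hp : pUp F (emaMap β μ x) = 1 - descProb F β μ x := by rw [hr]; ring
      rw [hp]
      have hq0 : 0 ≤ 1 - descProb F β μ x := by rw [hr]; linarith [pUp_nonneg F (emaMap β μ x)]
      have key : (1 - (1 - descProb F β μ x) ^ (m + 1))
            * ((descProb F β μ x)⁻¹ + hitExp F β μ n (dn F (emaMap β μ x)))
          = 1 + ((1 - descProb F β μ x) * ((1 - (1 - descProb F β μ x) ^ m)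
              * ((descProb F β μ x)⁻¹ + hitExp F β μ n (dn F (emaMap β μ x))))
            + (1 - (1 - descProb F β μ x)) * hitExp F β μ n (dn F (emaMap β μ x))) := by
        linear_combination hinv
      rw [key]
      have h1 := mul_le_mul_of_nonneg_left ih hq0
      have h2 : (1 - (1 - descProb F β μ x)) * hitExp F β μ n (dn F (emaMap β μ x))
          ≤ (1 - (1 - descProb F β μ x)) * hitExp F β μ (n + m) (dn F (emaMap β μ x)) :=
        mul_le_mul_of_nonneg_left hb (by linarith)
      linarith

/-! ### Where round-to-nearest is stuck, SR lingers and leaves -/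

/-- **SR leaves every RN trap.**  Let `x ∈ F` lie strictly above `μ` and satisfy the
round-to-nearest separation criterion of file III for the update `c = β x + (1 − β) μ`:
`2·|c − x| < |f − x|` for every other grid point `f` — so EVERY round-to-nearest trajectory is
stuck at `x` for ever (any tie rule, `rn_stuck_of_sep`).  Then under SR: the upper candidate of
`c` is `x` itself (lingering), and the descent probability satisfies `0 < descProb(x) < 1/2` —
expected sojourn `1/descProb(x) ∈ (2, ∞)` steps, after which the chain has left `x` downwards for
good. [new] -/
theorem linger_of_rn_sep {F : Finset K} {β μ x : K} (hμ : InHull F μ) (hβ0 : 0 ≤ β) (hβ1 : β < 1)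
    (hx : x ∈ F) (hμx : μ < x)
    (hsep : ∀ f ∈ F, f ≠ x → 2 * |emaMap β μ x - x| < |f - x|) :
    (∀ r, IsRN F (emaMap β μ x) r → r = x) ∧ up F (emaMap β μ x) = x ∧
      0 < descProb F β μ x ∧ descProb F β μ x < 1 / 2 := by
  have hF : F.Nonempty := ⟨x, hx⟩
  have hxh : InHull F x := ⟨⟨x, hx, le_rfl⟩, ⟨x, hx, le_rfl⟩⟩
  have hc : InHull F (emaMap β μ x) := emaMap_inHull hμ hxh hβ0 hβ1.le
  have hcx : emaMap β μ x < x := emaMap_lt hβ1 hμx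
  have habs : |emaMap β μ x - x| = x - emaMap β μ x := by
    rw [abs_sub_comm]; exact abs_of_pos (sub_pos.mpr hcx)
  have hux : up F (emaMap β μ x) = x := by
    by_contra hne
    have h1 := hsep _ (up_mem hF _) hne
    have h2 : up F (emaMap β μ x) ≤ x := up_le_of_mem hx hcx.le
    have h3 : emaMap β μ x ≤ up F (emaMap β μ x) := le_up_of_inHull hc
    rw [habs, abs_of_nonpos (sub_nonpos.mpr h2)] at h1
    linarith
  refine ⟨fun r hr => rn_stuck_of_sep hx hsep hr, hux, descProb_pos hμ hβ0 hβ1 hx hμx, ?_⟩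
  have hdc : dn F (emaMap β μ x) ≤ emaMap β μ x := dn_le_of_inHull hc
  have hne : dn F (emaMap β μ x) ≠ x := by intro h; linarith [h ▸ hdc]
  have h1 := hsep _ (dn_mem hF _) hne
  rw [habs, abs_of_nonpos (by linarith)] at h1
  rw [descProb_of_up_eq hμ hβ0 hβ1 hx hμx hux, div_lt_iff₀ (by linarith)]
  linarith

end Generic

/-! ### FP4 (E2M1) kernel witnesses: tracking `μ = 5/4` with `β = 3/4` -/

namespace FP4

/-- Round-to-nearest is STUCK at `3` and at `2` (separation criterion, every tie rule): the RN-EMA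
started at `3` reports `3` for ever while the target is `5/4`. -/
theorem e2m1_escape_rn_stuck : ∀ y ∈ ({2, 3} : Finset ℚ), y ∈ e2m1 ∧
    ∀ f ∈ e2m1, f ≠ y → 2 * |emaMap (3/4 : ℚ) (5/4) y - y| < |f - y| := by
  decide +kernel

/-- Under SR every state of the staircase `6 → 4 → 3 → 2 → {3/2, 1}` lingers (upper candidate =
the state) with descent probabilities `19/32, 11/16, 7/16, 3/8` … -/
theorem e2m1_escape_descProb :
    (up e2m1 (emaMap (3/4 : ℚ) (5/4) 6) = 6 ∧ descProb e2m1 (3/4 : ℚ) (5/4) 6 = 19/32) ∧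
    (up e2m1 (emaMap (3/4 : ℚ) (5/4) 4) = 4 ∧ descProb e2m1 (3/4 : ℚ) (5/4) 4 = 11/16) ∧
    (up e2m1 (emaMap (3/4 : ℚ) (5/4) 3) = 3 ∧ descProb e2m1 (3/4 : ℚ) (5/4) 3 = 7/16) ∧
    (up e2m1 (emaMap (3/4 : ℚ) (5/4) 2) = 2 ∧ descProb e2m1 (3/4 : ℚ) (5/4) 2 = 3/8) := by
  decide +kernel

/-- … so the escape budgets are `E T = 16/7 + 8/3 = 104/21 ≈ 4.95` from `3` and
`32/19 + 16/11 + 16/7 + 8/3 = 35512/4389 ≈ 8.09` from the top of the format. -/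
theorem e2m1_escape_budget :
    escBudget e2m1 (3/4 : ℚ) (5/4) 3 = 104/21 ∧ escBudget e2m1 (3/4 : ℚ) (5/4) 6 = 35512/4389 := by
  decide +kernel

/-- The truncated expected entry time from `3` at horizon `6`: `E[min(T, 6)] = 2240901/524288
≈ 4.27` (`≤ 104/21`, theorem `hitExp_le_escBudget`; the limit is `104/21`, theorem
`hitExp_linger_ge`). -/
theorem e2m1_escape_hitExp6 : hitExp e2m1 (3/4 : ℚ) (5/4) 6 3 = 2240901/524288 := by
  decide +kernel

end FP4

end Summit.Ventures.CertifiedArithmetic.LowPrec.SR
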